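import Summits.NavierStokesRegularity.FluidComputer.PartialRegularityFace
import Summits.NavierStokesRegularity.FluidComputer.PressureSerrinFace
import Summits.NavierStokesRegularity.FluidComputer.StrainSupFace
import Summits.NavierStokesRegularity.FluidComputer.GradientSerrinFace
import Summits.NavierStokesRegularity.FluidComputer.DirectionHolderFace
import Summits.NavierStokesRegularity.FluidComputer.DissipationConcentrationFace
import Summits.NavierStokesRegularity.FluidComputer.CascadeWitnessAnatomy
import HarnessLib

/-!
# Fluid computer — THE PROFILE OF A REALISED BLOW-UP, ASSEMBLED (gen 16 faces L37–L48) and READ ON THE INTERFACE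

HONEST FRAMING (cell `pub-fluidc`, verbatim): *low prior, high value-of-information experiment on Tao's
machine paradigm; NOT a claim that NS blows up.* Theorem side of the cell; nothing here is evidence of blow-up.
Companion of `BlowupAnatomy` (L30–L34 assembled). One statement for the paper's §4 collecting the gen-16 faces that
need no extra hypothesis, for every maximal smooth solution `(u, p)` of the unforced Navier–Stokes system on
`ℝ³ × [0, T)` (`ν > 0`) which is Leray–Hopf from `u 0`:

* `blowup_profile`: with ONE absolute `ε > 0` (Tsai's dissipation constant):
  (Σ) the blow-up set `{x | IsBackwardSingularPoint u (T,x)}` is nonempty, compact and `μH¹`-null (L37);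
  (P) on every terminal window the normalised pressure has no floor and lies in no Serrin class `L^s_tL^r_x`,
      `2/s + 3/r = 2`, `3/2 < r < ∞` (L38, L46);
  (E) on every terminal window `∫ m = ∞` for every time-only majorant `m` of the middle strain eigenvalue (L41″);
  (G) on every terminal window `∇u` lies in no class `L^q_tL^r_x`, `2/q + 3/r = 2`, `1 < q < ∞` (L47);
  (H) on every terminal window the vorticity direction is not ½-Hölder coherent over `{|ω| > Ω}`, any `Ω > 0`,
      any constant (L48);
  (D) at some focus `x₀` (a singular point) the normalised local dissipation exceeds `ε` along a sequence of scales: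
      `ε < limsup_{r↓0} r⁻¹∫∫_{Q_r(νT,x₀)}|∇w|²`, `w = ν⁻¹u(ν⁻¹·)` (L44).
* `blowup_profile_of_cascadeWitness`: the same read on the cell's interface structure `CascadeWitness`
  (via `x5a_of_cascadeWitness'`).

0 sorry; no new definitions, no named facts.

## References

* L. Caffarelli, R. Kohn, L. Nirenberg, Comm. Pure Appl. Math. 35 (1982) 771–831. [CKN1982]
* G. Seregin, V. Šverák, Arch. Ration. Mech. Anal. 163 (2002) 65–86. [SereginSverak2002]
* E. Miller, Arch. Ration. Mech. Anal. 237 (2020) 1237–1263. [Miller2019]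
* H. Beirão da Veiga, Chinese Ann. Math. Ser. B 16 (1995) 407–412. [BeiraoDaVeiga1995]
* H. Beirão da Veiga, L. C. Berselli, Differential Integral Equations 15 (2002) 345–356. [BeiraodaveigaBerselli2002]
* T.-P. Tsai, Arch. Rational Mech. Anal. 143 (1998) 29–51. [Tsai1998]
-/

noncomputable section

open MeasureTheory Set Function Filter Topology Metric
open scoped ENNReal NNReal
open Literature.Analysis.FluidPDE Literature.Analysis.FunctionSpaces Literature.Analysis.FluidPDE.FluidComputer
open Summit.NavierStokesRegularity.NavierStokesRegularity.Theorems.FluidComputer (x5a_of_cascadeWitness')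
open Summit.NavierStokesRegularity.FluidComputer.PartialRegularityFace
open Summit.NavierStokesRegularity.FluidComputer.PressureFace
open Summit.NavierStokesRegularity.FluidComputer.PressureSerrinFace
open Summit.NavierStokesRegularity.FluidComputer.StrainSupFace
open Summit.NavierStokesRegularity.FluidComputer.GradientSerrinFace
open Summit.NavierStokesRegularity.FluidComputer.DirectionHolderFace
open Summit.NavierStokesRegularity.FluidComputer.DissipationConcentrationFace

namespace Summit.NavierStokesRegularity.FluidComputer.BlowupProfile

/-- **THE PROFILE OF A REALISED BLOW-UP (L37, L38/L46, L41″, L47, L48, L44 assembled).** There is an absolute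
`ε > 0` such that for every `ν > 0`, `T > 0` and every maximal smooth solution `(u, p)` of the unforced
Navier–Stokes system on `ℝ³ × [0, T)` which is Leray–Hopf from `u 0`: (Σ) the blow-up set is nonempty, compact
and `μH¹`-null; (P) on every terminal window the normalised pressure dives below every level and is in no class
`L^s_tL^r_x` (`2/s + 3/r = 2`, `3/2 < r < ∞`); (E) the time integral of every nonnegative time-only Courant–Fischer
majorant of the middle strain eigenvalue diverges on every terminal window; (G) `∇u` is in no class `L^q_tL^r_x`
(`2/q + 3/r = 2`, `1 < q < ∞`) on any terminal window; (H) the vorticity direction is not ½-Hölder coherent over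
`{|ω| > Ω}` on any terminal window; (D) at some singular point `x₀` the normalised local dissipation of the
viscosity-normalised solution exceeds `ε` along a sequence of scales `r ↓ 0`.
[cite: CKN1982, Theorem B and Prop. 2] [cite: SereginSverak2002, Thm. 2.2] [cite: Miller2019, Thm 1.1]
[cite: BeiraoDaVeiga1995, Thm 1] [cite: BeiraodaveigaBerselli2002, Thm. 1.2] [cite: Tsai1998, Lemma 4.2] -/
theorem blowup_profile :
    ∃ ε : ℝ, 0 < ε ∧ ∀ (ν T : ℝ), 0 < ν → 0 < T →
      ∀ (u : ℝ → EuclideanSpace ℝ (Fin 3) → EuclideanSpace ℝ (Fin 3)) (p : ℝ → EuclideanSpace ℝ (Fin 3) → ℝ),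
      IsMaximalSmoothSolution ν 0 u p T → IsLerayHopfOn T ν 0 (u 0) u →
      -- (Σ) the blow-up set
      ({x | IsBackwardSingularPoint u ((T : ℝ), x)}.Nonempty ∧
        IsCompact {x | IsBackwardSingularPoint u ((T : ℝ), x)} ∧
        μH[1] {x | IsBackwardSingularPoint u ((T : ℝ), x)} = 0) ∧
      -- (P) the pressure
      (∀ t₀ ∈ Ico 0 T,
        (∀ K : ℝ, ∃ t ∈ Ioo t₀ T, ∃ x : EuclideanSpace ℝ (Fin 3), normalisedPressure (u t) x < -K) ∧
        ∀ (s r : ℝ≥0∞), 3 / 2 < r → r < ⊤ → 2 / s + 3 / r = 2 →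
          ¬ MemLqLp s r (fun t x => normalisedPressure (u t) x) (Ioo t₀ T)) ∧
      -- (E) the middle strain eigenvalue, time-only majorants
      (∀ m : ℝ → ℝ, (∀ t, 0 ≤ m t) →
        (∀ t ∈ Ico 0 T, ∀ x, ∃ v w : EuclideanSpace ℝ (Fin 3), ‖v‖ = 1 ∧ ‖w‖ = 1 ∧
          inner ℝ v w = 0 ∧ ∀ α β : ℝ,
            inner ℝ (fderiv ℝ (u t) x (α • v + β • w)) (α • v + β • w) ≤ m t * (α ^ 2 + β ^ 2)) →
        ∀ t₀ ∈ Ico 0 T, ∫⁻ t in Ioo t₀ T, ENNReal.ofReal (m t) = ⊤) ∧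
      -- (G) the gradient ladder
      (∀ (q r : ℝ≥0∞), 1 < q → q < ⊤ → 2 / q + 3 / r = 2 → ∀ t₀ ∈ Ico 0 T,
        ¬ MemLqLp q r (fun t x => fderiv ℝ (u t) x) (Ioo t₀ T)) ∧
      -- (H) the vorticity direction
      (∀ (Ω M : ℝ), 0 < Ω → ∀ t₀ ∈ Ico 0 T,
        ¬ (∀ t ∈ Ico t₀ T, ∀ x y : EuclideanSpace ℝ (Fin 3), Ω < ‖curl (u t) x‖ → Ω < ‖curl (u t) y‖ →
          Real.sqrt (1 - inner ℝ (vorticityDirection (curl (u t)) x) (vorticityDirection (curl (u t)) y) ^ 2) ≤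
            M * Real.sqrt ‖x - y‖)) ∧
      -- (D) dissipation concentration at a focus
      ∃ x₀ : EuclideanSpace ℝ (Fin 3),
        (∀ r : ℝ, 0 < r → ∀ K : ℝ, ∃ t ∈ Ioo (T - r ^ 2) T, 0 < t ∧ ∃ x ∈ ball x₀ r, K < ‖u t x‖) ∧
        ENNReal.ofReal ε <
          limsup (fun r : ℝ => (ENNReal.ofReal r)⁻¹ *
            ∫⁻ z in parabolicCylinder r ((T * ν : ℝ), x₀),
              ENNReal.ofReal (frobeniusNormSq (fderiv ℝ (timeRescale ν⁻¹ ν⁻¹ u z.1) z.2)))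
            (𝓝[>] (0 : ℝ)) := by
  obtain ⟨ε, hε, H⟩ := dissipation_concentration
  refine ⟨ε, hε, fun ν T hν hT u p hmax hLH => ⟨?_, ?_, ?_, ?_, ?_, H ν T hν hT u p hmax hLH⟩⟩
  · obtain ⟨h1, h2, h3, -⟩ := partial_regularity_face hν hT hmax hLH
    exact ⟨h1, h2, h3⟩
  · intro t₀ ht₀
    exact ⟨fun K => exists_normalisedPressure_lt_window hν hT hmax hLH K ht₀,
      fun s r hr hrtop hsr => not_memLqLp_normalisedPressure_window hν hmax hLH hr hrtop hsr ht₀⟩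
  · exact strain_sup_face hν hmax hLH
  · exact gradient_serrin_face hν hmax hLH
  · exact fun Ω M hΩ t₀ ht₀ => vorticityDirection_not_holderHalf_coherent hν hT hmax hLH hΩ M ht₀

/-- **THE PROFILE READ ON THE INTERFACE**: every `W : CascadeWitness` yields `ν > 0`, `T > 0` and a maximal smooth
Leray–Hopf solution with the profile (Σ)(P)(E)(G)(H)(D) of `blowup_profile` (same absolute `ε`).
[cite: CKN1982, Theorem B and Prop. 2] [cite: Miller2019, Thm 1.1] [cite: BeiraoDaVeiga1995, Thm 1] -/
theorem blowup_profile_of_cascadeWitness :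
    ∃ ε : ℝ, 0 < ε ∧ ∀ W : CascadeWitness, ∃ ν : ℝ, 0 < ν ∧ ∃ T : ℝ, 0 < T ∧
      ∃ (u : ℝ → EuclideanSpace ℝ (Fin 3) → EuclideanSpace ℝ (Fin 3))
        (p : ℝ → EuclideanSpace ℝ (Fin 3) → ℝ),
        IsMaximalSmoothSolution ν 0 u p T ∧ IsLerayHopfOn T ν 0 (u 0) u ∧
      ({x | IsBackwardSingularPoint u ((T : ℝ), x)}.Nonempty ∧
        IsCompact {x | IsBackwardSingularPoint u ((T : ℝ), x)} ∧
        μH[1] {x | IsBackwardSingularPoint u ((T : ℝ), x)} = 0) ∧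
      (∀ t₀ ∈ Ico 0 T,
        (∀ K : ℝ, ∃ t ∈ Ioo t₀ T, ∃ x : EuclideanSpace ℝ (Fin 3), normalisedPressure (u t) x < -K) ∧
        ∀ (s r : ℝ≥0∞), 3 / 2 < r → r < ⊤ → 2 / s + 3 / r = 2 →
          ¬ MemLqLp s r (fun t x => normalisedPressure (u t) x) (Ioo t₀ T)) ∧
      (∀ m : ℝ → ℝ, (∀ t, 0 ≤ m t) →
        (∀ t ∈ Ico 0 T, ∀ x, ∃ v w : EuclideanSpace ℝ (Fin 3), ‖v‖ = 1 ∧ ‖w‖ = 1 ∧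
          inner ℝ v w = 0 ∧ ∀ α β : ℝ,
            inner ℝ (fderiv ℝ (u t) x (α • v + β • w)) (α • v + β • w) ≤ m t * (α ^ 2 + β ^ 2)) →
        ∀ t₀ ∈ Ico 0 T, ∫⁻ t in Ioo t₀ T, ENNReal.ofReal (m t) = ⊤) ∧
      (∀ (q r : ℝ≥0∞), 1 < q → q < ⊤ → 2 / q + 3 / r = 2 → ∀ t₀ ∈ Ico 0 T,
        ¬ MemLqLp q r (fun t x => fderiv ℝ (u t) x) (Ioo t₀ T)) ∧
      (∀ (Ω M : ℝ), 0 < Ω → ∀ t₀ ∈ Ico 0 T,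
        ¬ (∀ t ∈ Ico t₀ T, ∀ x y : EuclideanSpace ℝ (Fin 3), Ω < ‖curl (u t) x‖ → Ω < ‖curl (u t) y‖ →
          Real.sqrt (1 - inner ℝ (vorticityDirection (curl (u t)) x) (vorticityDirection (curl (u t)) y) ^ 2) ≤
            M * Real.sqrt ‖x - y‖)) ∧
      ∃ x₀ : EuclideanSpace ℝ (Fin 3),
        (∀ r : ℝ, 0 < r → ∀ K : ℝ, ∃ t ∈ Ioo (T - r ^ 2) T, 0 < t ∧ ∃ x ∈ ball x₀ r, K < ‖u t x‖) ∧
        ENNReal.ofReal ε <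
          limsup (fun r : ℝ => (ENNReal.ofReal r)⁻¹ *
            ∫⁻ z in parabolicCylinder r ((T * ν : ℝ), x₀),
              ENNReal.ofReal (frobeniusNormSq (fderiv ℝ (timeRescale ν⁻¹ ν⁻¹ u z.1) z.2)))
            (𝓝[>] (0 : ℝ)) := by
  obtain ⟨ε, hε, H⟩ := blowup_profile
  refine ⟨ε, hε, fun W => ?_⟩
  obtain ⟨ν, hν, T, hT, u, p, hmax, hLH, -⟩ := x5a_of_cascadeWitness' W
  exact ⟨ν, hν, T, hT, u, p, hmax, hLH, H ν T hν hT u p hmax hLH⟩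

end Summit.NavierStokesRegularity.FluidComputer.BlowupProfile

end
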